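import Summits.QuantumFields.BalabanUV.Beta.FP.CoarseInverseScalar

/-!
# `BalabanUV.Beta.FP.ScalarMinimiserIdentification` — road «FP» (binder row D1), row **GAMMA-9 (I-gh)**, COMPANION 2 of
# `FP/ScalarMinimiserLetters`: THE IDENTIFICATION of (GH-a)'s spelling `𝓘_gh = G₀·Q′ᵀ·𝔊_gh` (`𝔊_gh = (Q′G₀Q′ᵀ)⁻¹` = `CoarseInverseScalar`'s
# `coarseInv = (n+1)^{−(d+2)}·actionKer n 1`) with pv23's penalised representation `kerH n a = G′Q′*(Q′G′Q′*)⁻¹` [B5 (1.103)] on `ℤ^d`: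
# `kerH n a p v = (n+1)^d · Σ'_y (Σ_{q∈B(y)} G₀(p − q)) · coarseInv(y, v)` for EVERY `a > 0`

HONEST DEPENDENCY (page 1, mandatory): continuum YM on T⁴ ⇐ BetaPertH ∧ nine spine estimates (0/9 proved); BetaPertH ⇐ (D1) ∧ (D4) ∧
CAP+tail; G-an2-4 gates asym, D1 and NE2/3/4.  HONEST FRAMING (cell contract, verbatim): «discharging `BetaPertH` makes Bałaban's UV
stability UNCONDITIONAL — a real constructive-QFT result; it is NOT the continuum limit and NOT the Clay problem.»  THIS MODULE is [folklore]
resolvent bookkeeping over tree identities BY NAME — leaf-06's `CoarseInverseScalarSteps.freeCol_eq` (STEP (2): `(n+1)⁻²G₀(p−q) = G′(p,q) +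
(n+1)^{−(d+2)}Σ'_z G′(p,z)S(blk z,q)`), `CoarseInverseScalar.tsum_M_mul_coarseInv` ((C3): `Σ'_y M(w,y)·coarseInv(y,u) = [w = u]`), pv23's
`B5Hk103ScalarZd` (`kerH`, `gq`, `summable_kerH`, `tsum_blocks`, `abs_gq_le`, `abs_Kinv_le`) and `B5Hk103Unique.kerH_eq_kerH` (`a`-independence);
no `def`, no `def … : Prop`, nothing cited, 0 sorry.  The object is pv23's SCALAR whole-lattice minimiser; nothing of Bałaban's vector `H_k` is
asserted.  NOT (GH-a), NOT `hbook`, NOT D1, NOT BetaPertH, NOT continuum, NOT Clay.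

ABSOLUTE RULE (cell charter, verbatim): «No internally-minted statement may enter as a cited fact. Every hypothesis is either kernel-proved in this
package or a verbatim quotation of a PUBLISHED theorem with page reference. The manuscript(s) under audit are NOT citable for their own disputed
steps — they are the thing under adjudication; programme-internal (2001/route/tribunal) claims are never citable.»

THE COMPUTATION (`N = n+1`, `c := N^{−(d+2)}`, `G₀ = latticeGreen∕2`, `S̃(p,y) := Σ_{q∈B(y)} G₀(p−q)` = the `(p,y)` entry of `G₀Q′ᵀ` for the
block-SUM matrix `Q′ᵀ`, `M(u,y) := Σ_{r∈B(u)}Σ_{q∈B(y)} G₀(r−q)`, `coarseInv(y,v) := c·actionKer n 1 y v`, `actionKer = Kinv − δ`).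
(★) summing STEP (2) over `q ∈ B(y)` and regrouping `z` by blocks (`tsum_blocks`):  `N⁻²·S̃(p,y) = gq(p,y) + c·Σ'_u gq(p,u)·M(u,y)`;
(★★) contracting (★) with `coarseInv(·,v)`: the first term gives `c·(kerH(p,v) − gq(p,v))` (`kerH = Σ' gq·Kinv`, `actionKer = Kinv − δ`), the second
`c·Σ'_u gq(p,u)·[u = v] = c·gq(p,v)` by Fubini (product majorant) and (C3); hence **`kerH n 1 p v = N^d·Σ'_y S̃(p,y)·coarseInv(y,v)`**, and
`kerH n a = kerH n 1` extends it to every `a > 0`.  In (GH-a)'s words: with the block-AVERAGE `Q′ = N^{−d}·𝟙[· ∈ B(y)]`, `G₀Q′ᵀ = N^{−d}S̃`,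
`Q′G₀Q′ᵀ = N^{−2d}M`, `𝔊_gh = (Q′G₀Q′ᵀ)⁻¹ = N^{2d}·coarseInv`, so `G₀Q′ᵀ𝔊_gh = N^d·S̃·coarseInv = kerH` — pv23's minimiser IS the ghost dictionary's `𝓘`.
Provenance: unit `b2b-balaban-t4-ne7b-formalise-leaf-10` (gen 26), 2026-08-21; «not in print; our bookkeeping».
-/

noncomputable section

namespace Summit.QuantumFields.BalabanUV.Beta.FP.ScalarMinimiserIdentification

open Finset
open scoped BigOperators
open Literature.Probability.LatticeModels (latticeGreen)
open Literature.MathematicalPhysics.QuantumFieldTheory.Balaban1983to89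
open B6QGQLower276 (X B blk mem_B sum_B_const)
open B6QGQDecay237 (cU deltaU cInv deltaInv cU_pos deltaU_pos cInv_pos deltaInv_pos)
open B5Hk103ScalarZd (Gk Kinv gq kerH abs_gq_le abs_Kinv_le summable_kerH summable_expX tsum_blocks)
open B5Hk165ActionZd (actionKer)
open B5Hk103Unique (kerH_eq_kerH)
open CoarseInverseScalarSteps (abs_G0_le abs_blockCol_le abs_M_le freeCol_eq summable_Gk_mul_bdd)
open CoarseInverseScalar (tsum_M_mul_coarseInv abs_coarseInv_le)

variable {d : ℕ}

/-! ## §1 Step (★): the free block column through the penalised one -/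

/-- [folklore] on a block, `Σ_{z∈B(u)} G′(p,z)·F(blk z) = gq(p,u)·F(u)`. -/
theorem sum_B_Gk_mul_comp_blk (n : ℕ) (p u : X d) (F : X d → ℝ) :
    ∑ z ∈ B n u, Gk n 1 p z * F (blk n z) = gq n 1 p u * F u := by
  rw [gq, Finset.sum_mul]
  exact Finset.sum_congr rfl fun z hz => by rw [mem_B.1 hz]

/-- **(★)** `(n+1)⁻²·Σ_{q∈B(y)} G₀(p−q) = gq n 1 p y + (n+1)^{−(d+2)}·Σ'_u gq n 1 p u · M(u,y)`. [folklore] -/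
theorem freeBlockCol_eq (hd : 3 ≤ d) (n : ℕ) (p y : X d) :
    (∑ q ∈ B n y, latticeGreen (p - q) / 2) / ((n : ℝ) + 1) ^ 2
      = gq n 1 p y + (((n : ℝ) + 1) ^ (d + 2))⁻¹ *
          ∑' u, gq n 1 p u * ∑ r ∈ B n u, ∑ q ∈ B n y, latticeGreen (r - q) / 2 := by
  set c : ℝ := (((n : ℝ) + 1) ^ (d + 2))⁻¹ with hc
  -- the summable family `z ↦ G′(p,z)·S(blk z, q)` and its block-summed version
  have hsum : ∀ q : X d, Summable fun z : X d => Gk n 1 p z * ∑ r ∈ B n (blk n z), latticeGreen (r - q) / 2 :=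
    fun q => summable_Gk_mul_bdd n p (fun z => abs_blockCol_le hd n (blk n z) q)
  have h1 : (∑ q ∈ B n y, latticeGreen (p - q) / 2) / ((n : ℝ) + 1) ^ 2
      = ∑ q ∈ B n y, (Gk n 1 p q + c * ∑' z, Gk n 1 p z * ∑ r ∈ B n (blk n z), latticeGreen (r - q) / 2) := by
    rw [Finset.sum_div]
    exact Finset.sum_congr rfl fun q _ => freeCol_eq hd n p q
  rw [h1, Finset.sum_add_distrib]
  congr 1
  rw [← Finset.mul_sum]
  congr 1
  -- swap the finite `q`-sum with the `z`-series, then regroup `z` by blocks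
  rw [← Summable.tsum_finsetSum (fun q _ => hsum q)]
  have hF : Summable fun z : X d => Gk n 1 p z * ∑ q ∈ B n y, ∑ r ∈ B n (blk n z), latticeGreen (r - q) / 2 := by
    have := summable_sum (s := B n y) fun q (_ : q ∈ B n y) => hsum q
    refine this.congr fun z => ?_
    rw [Finset.mul_sum]
  have e1 : ∀ z : X d, ∑ q ∈ B n y, Gk n 1 p z * ∑ r ∈ B n (blk n z), latticeGreen (r - q) / 2
      = Gk n 1 p z * ∑ r ∈ B n (blk n z), ∑ q ∈ B n y, latticeGreen (r - q) / 2 := by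
    intro z
    simp_rw [Finset.mul_sum]
    rw [Finset.sum_comm]
  rw [tsum_congr e1]
  have hF' : Summable fun z : X d => Gk n 1 p z * ∑ r ∈ B n (blk n z), ∑ q ∈ B n y, latticeGreen (r - q) / 2 := by
    refine hF.congr fun z => ?_
    simp_rw [Finset.mul_sum]
    rw [Finset.sum_comm]
  rw [← tsum_blocks n hF']
  exact tsum_congr fun u => sum_B_Gk_mul_comp_blk n p u
    (fun w => ∑ r ∈ B n w, ∑ q ∈ B n y, latticeGreen (r - q) / 2)

/-! ## §2 A product-majorant Fubini lemma -/

/-- [folklore] Fubini on `ℤ^d × ℤ^d` under a PRODUCT majorant `|F u y| ≤ A u · B y` (`A, B ≥ 0` summable). -/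
theorem tsum_comm_of_prod_majorant {F : X d → X d → ℝ} {A Bw : X d → ℝ} (hA : Summable A) (hB : Summable Bw)
    (hA0 : ∀ u, 0 ≤ A u) (hB0 : ∀ y, 0 ≤ Bw y) (hF : ∀ u y, |F u y| ≤ A u * Bw y) :
    Summable (Function.uncurry F) ∧ ∑' y, ∑' u, F u y = ∑' u, ∑' y, F u y := by
  have hs : Summable (Function.uncurry F) := by
    refine Summable.of_norm_bounded (hA.mul_of_nonneg hB hA0 hB0) fun uy => ?_
    rw [Real.norm_eq_abs]
    exact hF uy.1 uy.2
  refine ⟨hs, ?_⟩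
  exact hs.tsum_comm' (fun u => hs.prod_factor u) (fun y => hs.prod_symm.prod_factor y)

/-! ## §3 Step (★★): the identification -/

/-- **THE IDENTIFICATION, `a = 1`**: `kerH n 1 p v = (n+1)^d · Σ'_y (Σ_{q∈B(y)} G₀(p−q)) · coarseInv(y,v)`,
`coarseInv(y,v) = (n+1)^{−(d+2)}·actionKer n 1 y v`. [folklore] -/
theorem kerH_one_eq_tsum_freeBlockCol_mul_coarseInv (hd : 3 ≤ d) (n : ℕ) (p v : X d) :
    kerH n 1 p v = ((n : ℝ) + 1) ^ d *
      ∑' y, (∑ q ∈ B n y, latticeGreen (p - q) / 2) * ((((n : ℝ) + 1) ^ (d + 2))⁻¹ * actionKer n 1 y v) := by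
  have hN : (0 : ℝ) < (n : ℝ) + 1 := by positivity
  set c : ℝ := (((n : ℝ) + 1) ^ (d + 2))⁻¹ with hc
  have hc0 : 0 < c := by positivity
  set M : X d → X d → ℝ := fun u y => ∑ r ∈ B n u, ∑ q ∈ B n y, latticeGreen (r - q) / 2 with hM
  set cI : X d → X d → ℝ := fun y w => c * actionKer n 1 y w with hcI
  -- sizes: `|gq| ≤ Cg·e^{−δu·dist(blk p, ·)}`, `|M| ≤ Mb`, `|cI(·,v)| ≤ CI·e^{−δI·dist(·,v)}`
  set Cg : ℝ := cU d 1 * Real.sqrt (((n : ℝ) + 1) ^ d) with hCg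
  have hgq : ∀ u, |gq n 1 p u| ≤ Cg * Real.exp (-(deltaU d 1 * dist (blk n p) u)) := fun u => abs_gq_le n one_pos p u
  set Mb : ℝ := ((n : ℝ) + 1) ^ d * (((n : ℝ) + 1) ^ d * (latticeGreen (0 : X d) / 2)) with hMb
  have hMle : ∀ u y, |M u y| ≤ Mb := fun u y => abs_M_le hd n u y
  set CI : ℝ := (cInv d 1 + 1) * c with hCI
  have hcIle : ∀ y, |cI y v| ≤ CI * Real.exp (-(deltaInv d 1 * dist y v)) := by
    intro y
    have h := abs_coarseInv_le (d := d) n y v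
    simp only [hcI, hCI]
    calc |c * actionKer n 1 y v| ≤ (cInv d 1 + 1) * c * Real.exp (-(deltaInv d 1 * dist y v)) := h
      _ = _ := rfl
  have hCg0 : 0 ≤ Cg := by have := (cU_pos d one_pos).le; positivity
  have hMb0 : 0 ≤ Mb := by
    have := Literature.Probability.LatticeModels.latticeGreen_nonneg d hd (0 : X d)
    positivity
  have hCI0 : 0 ≤ CI := by have := (cInv_pos d one_pos).le; positivity
  -- (i) contract (★) with `cI(·,v)`
  have hstar : ∀ y, (∑ q ∈ B n y, latticeGreen (p - q) / 2) * cI y v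
      = ((n : ℝ) + 1) ^ 2 * (gq n 1 p y * cI y v + c * ((∑' u, gq n 1 p u * M u y) * cI y v)) := by
    intro y
    have h := freeBlockCol_eq hd n p y
    rw [div_eq_iff (by positivity)] at h
    rw [h]; ring
  -- (ii) summability of the pieces
  have hs1 : Summable fun y => gq n 1 p y * cI y v := by
    refine Summable.of_norm_bounded ((summable_expX (deltaInv_pos d one_pos) v).mul_left (Cg * CI)) fun y => ?_
    rw [Real.norm_eq_abs, abs_mul]
    have e1 : Real.exp (-(deltaU d 1 * dist (blk n p) y)) ≤ 1 :=
      Real.exp_le_one_iff.mpr (by have := (deltaU_pos d one_pos).le; nlinarith [@dist_nonneg _ _ (blk n p) y])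
    have hg1 : |gq n 1 p y| ≤ Cg := (hgq y).trans (by nlinarith)
    have h3 := hcIle y
    rw [dist_comm] at h3
    calc |gq n 1 p y| * |cI y v| ≤ Cg * (CI * Real.exp (-(deltaInv d 1 * dist v y))) :=
          mul_le_mul hg1 h3 (abs_nonneg _) hCg0
      _ = Cg * CI * Real.exp (-(deltaInv d 1 * dist v y)) := by ring
  -- the double family `(u, y) ↦ gq(p,u)·M(u,y)·cI(y,v)` under the product majorant
  have hprod := tsum_comm_of_prod_majorant (d := d)
    (F := fun u y => gq n 1 p u * M u y * cI y v)
    (A := fun u => Cg * Real.exp (-(deltaU d 1 * dist (blk n p) u)))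
    (Bw := fun y => Mb * CI * Real.exp (-(deltaInv d 1 * dist v y)))
    ((summable_expX (deltaU_pos d one_pos) (blk n p)).mul_left Cg)
    ((summable_expX (deltaInv_pos d one_pos) v).mul_left (Mb * CI))
    (fun u => by positivity) (fun y => by positivity)
    (fun u y => by
      rw [abs_mul, abs_mul]
      have h3 := hcIle y
      rw [dist_comm] at h3
      calc |gq n 1 p u| * |M u y| * |cI y v|
          ≤ (Cg * Real.exp (-(deltaU d 1 * dist (blk n p) u))) * Mb * (CI * Real.exp (-(deltaInv d 1 * dist v y))) :=
            mul_le_mul (mul_le_mul (hgq u) (hMle u y) (abs_nonneg _) (by positivity)) h3 (abs_nonneg _) (by positivity)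
        _ = _ := by ring)
  obtain ⟨hsU, hcomm⟩ := hprod
  have hs2row : ∀ y, Summable fun u => gq n 1 p u * M u y * cI y v := fun y => hsU.prod_symm.prod_factor y
  have hs2 : Summable fun y => (∑' u, gq n 1 p u * M u y) * cI y v := by
    have h := hsU.prod_symm.prod
    refine (h.congr fun y => ?_)
    change ∑' u, gq n 1 p u * M u y * cI y v = _
    rw [← tsum_mul_right]
  -- (iii) evaluate the two contracted pieces
  have hpiece1 : ∑' y, gq n 1 p y * cI y v = c * (kerH n 1 p v - gq n 1 p v) := by
    have hsA : Summable fun y => gq n 1 p y * Kinv n 1 y v := summable_kerH n one_pos p v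
    have hsB : Summable fun y => gq n 1 p y * (if y = v then (1 : ℝ) else 0) :=
      summable_of_ne_finset_zero (s := {v}) (fun y hy => by
        rw [Finset.mem_singleton] at hy
        rw [if_neg hy, mul_zero])
    have e : ∀ y, gq n 1 p y * cI y v = c * (gq n 1 p y * Kinv n 1 y v - gq n 1 p y * (if y = v then 1 else 0)) := by
      intro y; simp only [hcI, actionKer]; ring
    have hδ : ∑' y, gq n 1 p y * (if y = v then (1 : ℝ) else 0) = gq n 1 p v := by
      rw [tsum_eq_single v (fun y hy => by rw [if_neg hy, mul_zero]), if_pos rfl, mul_one]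
    rw [tsum_congr e, tsum_mul_left, hsA.tsum_sub hsB, hδ, kerH]
  have hpiece2 : ∑' y, (∑' u, gq n 1 p u * M u y) * cI y v = gq n 1 p v := by
    have e : ∀ y, (∑' u, gq n 1 p u * M u y) * cI y v = ∑' u, gq n 1 p u * M u y * cI y v := by
      intro y; rw [← tsum_mul_right]
    rw [tsum_congr e, hcomm]
    have e2 : ∀ u, ∑' y, gq n 1 p u * M u y * cI y v = gq n 1 p u * ∑' y, M u y * cI y v := by
      intro u; rw [← tsum_mul_left]; exact tsum_congr fun y => by ring
    rw [tsum_congr e2]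
    have e3 : ∀ u, ∑' y, M u y * cI y v = if u = v then 1 else 0 := fun u => tsum_M_mul_coarseInv hd n u v
    rw [tsum_congr (fun u => by rw [e3 u]), tsum_eq_single v (fun u hu => by rw [if_neg hu, mul_zero]), if_pos rfl, mul_one]
  -- (iv) assemble
  have htot : ∑' y, (∑ q ∈ B n y, latticeGreen (p - q) / 2) * cI y v = ((n : ℝ) + 1) ^ 2 * (c * kerH n 1 p v) := by
    rw [tsum_congr hstar, tsum_mul_left, Summable.tsum_add hs1 (hs2.mul_left c), tsum_mul_left, hpiece1, hpiece2]
    ring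
  have hcN : ((n : ℝ) + 1) ^ d * (((n : ℝ) + 1) ^ 2 * c) = 1 := by
    rw [hc]; field_simp; ring
  calc kerH n 1 p v = ((n : ℝ) + 1) ^ d * (((n : ℝ) + 1) ^ 2 * c) * kerH n 1 p v := by rw [hcN, one_mul]
    _ = ((n : ℝ) + 1) ^ d * (((n : ℝ) + 1) ^ 2 * (c * kerH n 1 p v)) := by ring
    _ = ((n : ℝ) + 1) ^ d * ∑' y, (∑ q ∈ B n y, latticeGreen (p - q) / 2) * cI y v := by rw [htot]

/-- **THE IDENTIFICATION, every `a > 0`** (`B5Hk103Unique.kerH_eq_kerH`): `kerH n a p v = (n+1)^d · Σ'_y (Σ_{q∈B(y)} G₀(p−q)) · coarseInv(y,v)`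
— pv23's penalised minimiser kernel IS (GH-a)'s `G₀Q′ᵀ𝔊_gh` (block-average normalisation: `G₀Q′ᵀ = (n+1)^{−d}S̃`, `𝔊_gh = (n+1)^{2d}·coarseInv`).
[folklore] -/
theorem kerH_eq_tsum_freeBlockCol_mul_coarseInv (hd : 3 ≤ d) (n : ℕ) {a : ℝ} (ha : 0 < a) (p v : X d) :
    kerH n a p v = ((n : ℝ) + 1) ^ d *
      ∑' y, (∑ q ∈ B n y, latticeGreen (p - q) / 2) * ((((n : ℝ) + 1) ^ (d + 2))⁻¹ * actionKer n 1 y v) := by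
  rw [kerH_eq_kerH n ha one_pos]
  exact kerH_one_eq_tsum_freeBlockCol_mul_coarseInv hd n p v

end Summit.QuantumFields.BalabanUV.Beta.FP.ScalarMinimiserIdentification

end
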